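import Mathlib
import Literature.MathematicalPhysics.QuantumLattice.DWaveKomaTasakiSystem
import Literature.MathematicalPhysics.QuantumLattice.DWaveSourceNNNHopping
import HarnessLib

/-!
# KKT-blindness at fixed field: `U(1)`-invariant pseudo-states pass every sourced KKT row that is not a
# torque or pair-transfer entry (hubbard-cq census (38), matrix level)

HONEST FRAMING: first certified bounds; not a superconductivity verdict. This file is certificate-GRAMMAR
bookkeeping about what the rows of a sourced KKT relaxation can and cannot see; nothing here is a number, an
order parameter or a phase word.

Cell hubbard-cq (the CUPRATE QUESTION), card `sourced-kkt-one-point-floor` (transplant-2 ⊕ dual-2, SURVIVES,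
new-combination) and lens negation-1's law S6; this is the kernel-checked kit of **hubbard-cq-critic-1 g2 (author of
the sketch `HOME/lean/KKTBlindness.critic1.lean`, sha16 d451598fd5af0cb6)**, landed by hubbard-cq-p6 (lead ACKS 23,
2026-08-27T00:21Z) so that the census and the Edison repair census point at declarations. CENSUS (38) OF RECORD
(critic-1 00:02Z 08-27, adopted; CONFIRMED 23:57Z 08-26 by hubbard-cq-pilot-1's job K = kit j260087 at K5-class
grand-canonical-without-filling, CHARGE-HOMOGENEOUS KKT blocks only): «the `U(1)`-invariant zero-torque slice of the
sourced charged-KKT program at `(U, μ, t′) = (8, 7/4, 0)` is non-empty; hence sourced KKT one-point floors WITHOUT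
energy/filling rows are vacuous at every `h ≤ 0.202`; mechanism (negation-1 S6, critic-1 O10, critic-2 TEST A):
invariant pseudo-states pass every sourced first-order row and see the field only through torque entries that nothing
pins». Job K numbers: K1a / K1b / K2a = −1.3508684 / −1.0735396 / −1.5562224 certified `≤ 0`; KZa = the
`U(1)`-invariant zero-charge slice FEASIBLE, objective `0 ± 9e-7` ⇒ vacuous for all `h ≤ 0.202` by nesting
(`posSemidef_sub_smul_of_le` below). Class precision (critic-2 g3 00:32Z 08-27): the charge-MIXED Nambu block was not
built by job K (UNTRIED K1m / KZm); the statements below are exactly about charge-HOMOGENEOUS generators.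

SETTING (pure `Matrix n n ℂ` bookkeeping): a Hermitian "charge" `Nc`, a neutral part `K` (`[Nc, K] = 0`, think
`H − μN`), a pair field `D` of charge `−2` (`[Nc, D] = −2·D`, think `Δ_d`), the sourced matrix `A(h) = K − h·(D + Dᴴ)`,
and a linear functional `ω` vanishing on every matrix of non-zero charge (a `U(1)`-invariant pseudo-state).
* `HasCharge Nc q X` (`Nc X − X Nc = q • X`) with its algebra (`mul`, `comm`, `conjTranspose`, …) and
  `IsInvariant Nc ω`; §5 shows the tree's objects fit: `hasCharge_pairField` (`Δ_g` has charge `−2` under `N`,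
  KT94 (2.16) = `DWaveKT.pairField_mul_totalNumber`), `hasCharge_dWaveSourceTorusTT'_source_zero` (the unsourced
  `t–t′` torus is neutral); the shape `A_L(h) = K − h(Δ_d + Δ_dᴴ)` is the tree's
  `Observables.dWaveSourceTorusTT'_eq_zero_source_sub` (`SubGapResponseFluctuationWindow`).
* `firstOrder_sourced_of_invariant`: the sourced first-order row `ω([A(h), C]) = 0` for a generator of charge `q`
  follows from the UNSOURCED row (needed iff `q = 0`) and the TORQUE rows `ω([D, C]) = 0` / `ω([Dᴴ, C]) = 0`
  (needed iff `q = ±2`).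
* `secondOrder_entry_of_invariant`: the sourced second-order entry `ω(Cᵢᴴ[A(h), Cⱼ])` is the charge-DIAGONAL
  unsourced entry minus `h`× the PAIR-TRANSFER entries (charges differing by `2`): `Q_h = Q₀ − h·T`.
* `posSemidef_sub_smul_of_le`: `Q₀ ⪰ 0 ∧ Q₀ − hT ⪰ 0 ⇒ Q₀ − h'T ⪰ 0` for `0 ≤ h' ≤ h` (blindness nests downward).
* `expect_eq_zero_of_invariant`: every charged one-point function (e.g. `ω(D)`) vanishes — objective `0`.
* `wbEntry_eq_zero_of_invariant`: the Ward–Bogoliubov border entry `ω([Nc, [A(h), Y]])` vanishes on invariant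
  `ω` passing the sourced first-order and torque rows (Jacobi: `charge_doubleComm`, `charge_comm_sourced`) —
  the `Nc`-row of the WB matrix is the torque vector. The WB block itself, its Ward value and the adjoint charge
  relation in the `G = N/2` normalisation are p1's `Observables/WardBogoliubovBorder.lean` (`charge_conjTranspose`,
  `ward_doubleCommutator`, `posSemidef_doubleCommutatorBlock`) — cited, not restated (`HasCharge.conjTranspose`
  below is the general-charge form).
* `mixture_law` / `mixture_law_blind` (S7-type): with a convex feasible set, linear energy and objective, a blind
  feasible point of energy `u + τ` and a physical one of energy `u − D` and objective `m₁`, the certified minimum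
  under the cap `E ≤ u` is at most `m₁·τ/(D + τ)`, and `≤ 0` when the blind point meets the cap.
Zero compute; no `sorry`; two `def`s (`HasCharge`, `IsInvariant`: grammar predicates, no junk values).
-/

noncomputable section

namespace Summit.Ventures.CertifiedManyBodySolver.Observables

open Matrix
open scoped ComplexOrder

namespace KKTBlindness

variable {n : Type*} [Fintype n]

/-! ### §1 Charges and invariant functionals -/

/-- `X` has charge `q` under the (charge) matrix `Nc`: `Nc X − X Nc = q • X`. For the `d`-wave pair field under
the particle number this is KT94 (2.16) with `q = −2` (`hasCharge_pairField`). -/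
def HasCharge (Nc : Matrix n n ℂ) (q : ℤ) (X : Matrix n n ℂ) : Prop :=
  Nc * X - X * Nc = (q : ℂ) • X

namespace HasCharge

variable {Nc X Y : Matrix n n ℂ} {a b : ℤ}

/-- Charges add under products. -/
theorem mul (hX : HasCharge Nc a X) (hY : HasCharge Nc b Y) :
    HasCharge Nc (a + b) (X * Y) := by
  unfold HasCharge at *
  have h1 : Nc * (X * Y) - X * Y * Nc = (Nc * X - X * Nc) * Y + X * (Nc * Y - Y * Nc) := by
    simp only [sub_mul, mul_sub, Matrix.mul_assoc]; abel
  rw [h1, hX, hY, Matrix.smul_mul, Matrix.mul_smul, Int.cast_add, add_smul]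

/-- A difference of two charge-`a` matrices has charge `a`. -/
theorem sub (hX : HasCharge Nc a X) (hY : HasCharge Nc a Y) :
    HasCharge Nc a (X - Y) := by
  unfold HasCharge at *
  have h1 : Nc * (X - Y) - (X - Y) * Nc = (Nc * X - X * Nc) - (Nc * Y - Y * Nc) := by
    simp only [sub_mul, mul_sub]; abel
  rw [h1, hX, hY, smul_sub]

/-- A sum of two charge-`a` matrices has charge `a`. -/
theorem add (hX : HasCharge Nc a X) (hY : HasCharge Nc a Y) :
    HasCharge Nc a (X + Y) := by
  unfold HasCharge at *
  have h1 : Nc * (X + Y) - (X + Y) * Nc = (Nc * X - X * Nc) + (Nc * Y - Y * Nc) := by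
    simp only [add_mul, mul_add]; abel
  rw [h1, hX, hY, smul_add]

/-- Scalar multiples keep the charge. -/
theorem smul (hX : HasCharge Nc a X) (c : ℂ) : HasCharge Nc a (c • X) := by
  unfold HasCharge at *
  rw [Matrix.mul_smul, Matrix.smul_mul, ← smul_sub, hX, smul_comm]

/-- The commutator of charge-`a` and charge-`b` matrices has charge `a + b`. -/
theorem comm (hX : HasCharge Nc a X) (hY : HasCharge Nc b Y) :
    HasCharge Nc (a + b) (X * Y - Y * X) := by
  have h2 : HasCharge Nc (a + b) (Y * X) := by simpa [add_comm] using hY.mul hX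
  exact (hX.mul hY).sub h2

/-- Adjoint flips the charge (for a Hermitian charge matrix); the `q = −1`, `Nc = N/2` instance is p1's
`charge_conjTranspose` (`WardBogoliubovBorder`). -/
theorem conjTranspose (hNc : Ncᴴ = Nc) (hX : HasCharge Nc a X) :
    HasCharge Nc (-a) Xᴴ := by
  unfold HasCharge at *
  have h1 := congrArg Matrix.conjTranspose hX
  rw [conjTranspose_sub, conjTranspose_mul, conjTranspose_mul, hNc, conjTranspose_smul,
    star_intCast] at h1
  rw [Int.cast_neg, neg_smul, ← h1]; abel

end HasCharge

/-- A `U(1)`-invariant functional ("invariant pseudo-state"): zero on every matrix of non-zero charge. -/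
def IsInvariant (Nc : Matrix n n ℂ) (ω : Matrix n n ℂ →ₗ[ℂ] ℂ) : Prop :=
  ∀ (q : ℤ) (X : Matrix n n ℂ), q ≠ 0 → HasCharge Nc q X → ω X = 0

/-! ### §2 The sourced first- and second-order rows on an invariant functional -/

section Rows

variable {Nc K D : Matrix n n ℂ} {ω : Matrix n n ℂ →ₗ[ℂ] ℂ}

/-- **First-order rows.** For an invariant `ω` and a generator `C` of charge `q`, the SOURCED row
`ω([K − h(D + Dᴴ), C]) = 0` follows from: the unsourced row (needed only if `q = 0`) and the torque rows
(needed only if `q = 2`, resp. `q = −2`); every other charge contributes nothing. -/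
theorem firstOrder_sourced_of_invariant (hNc : Ncᴴ = Nc) (hK : HasCharge Nc 0 K)
    (hD : HasCharge Nc (-2) D) (hω : IsInvariant Nc ω) (h : ℂ) {C : Matrix n n ℂ} {q : ℤ}
    (hC : HasCharge Nc q C)
    (ha : q = 0 → ω (K * C - C * K) = 0)
    (hb : q = 2 → ω (D * C - C * D) = 0)
    (hb' : q = -2 → ω (Dᴴ * C - C * Dᴴ) = 0) :
    ω ((K - h • (D + Dᴴ)) * C - C * (K - h • (D + Dᴴ))) = 0 := by
  have hDh : HasCharge Nc 2 Dᴴ := by simpa using hD.conjTranspose hNc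
  have e : (K - h • (D + Dᴴ)) * C - C * (K - h • (D + Dᴴ))
      = (K * C - C * K) - h • (D * C - C * D) - h • (Dᴴ * C - C * Dᴴ) := by
    simp only [sub_mul, mul_sub, add_mul, mul_add, Matrix.smul_mul, Matrix.mul_smul, smul_sub,
      smul_add]; abel
  rw [e, map_sub, map_sub, map_smul, map_smul]
  have t1 : ω (K * C - C * K) = 0 := by
    by_cases hq : q = 0
    · exact ha hq
    · exact hω q _ hq (by simpa using hK.comm hC)
  have t2 : ω (D * C - C * D) = 0 := by
    by_cases hq : q = 2
    · exact hb hq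
    · exact hω (-2 + q) _ (by omega) (hD.comm hC)
  have t3 : ω (Dᴴ * C - C * Dᴴ) = 0 := by
    by_cases hq : q = -2
    · exact hb' hq
    · exact hω (2 + q) _ (by omega) (hDh.comm hC)
  simp [t1, t2, t3]

/-- **Second-order entries.** For an invariant `ω` and generators `Cᵢ`, `Cⱼ` of charges `qᵢ`, `qⱼ`, the sourced KKT
entry `ω(Cᵢᴴ [K − h(D + Dᴴ), Cⱼ])` is the charge-diagonal unsourced entry minus `h` times the pair-transfer entries,
which couple only charges differing by `2` (`Q_h = Q₀ − h·T`). -/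
theorem secondOrder_entry_of_invariant (hNc : Ncᴴ = Nc) (hK : HasCharge Nc 0 K)
    (hD : HasCharge Nc (-2) D) (hω : IsInvariant Nc ω) (h : ℂ) {Ci Cj : Matrix n n ℂ} {qi qj : ℤ}
    (hCi : HasCharge Nc qi Ci) (hCj : HasCharge Nc qj Cj) :
    ω (Ciᴴ * ((K - h • (D + Dᴴ)) * Cj - Cj * (K - h • (D + Dᴴ)))) =
      (if qi = qj then ω (Ciᴴ * (K * Cj - Cj * K)) else 0)
      - h * ((if qj = qi + 2 then ω (Ciᴴ * (D * Cj - Cj * D)) else 0)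
             + (if qj = qi - 2 then ω (Ciᴴ * (Dᴴ * Cj - Cj * Dᴴ)) else 0)) := by
  have hDh : HasCharge Nc 2 Dᴴ := by simpa using hD.conjTranspose hNc
  have hCih : HasCharge Nc (-qi) Ciᴴ := hCi.conjTranspose hNc
  have e : Ciᴴ * ((K - h • (D + Dᴴ)) * Cj - Cj * (K - h • (D + Dᴴ)))
      = Ciᴴ * (K * Cj - Cj * K) - h • (Ciᴴ * (D * Cj - Cj * D)) - h • (Ciᴴ * (Dᴴ * Cj - Cj * Dᴴ)) := by
    simp only [sub_mul, mul_sub, add_mul, mul_add, Matrix.smul_mul, Matrix.mul_smul, smul_sub,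
      smul_add]; abel
  rw [e, map_sub, map_sub, map_smul, map_smul]
  have t1 : ω (Ciᴴ * (K * Cj - Cj * K)) = if qi = qj then ω (Ciᴴ * (K * Cj - Cj * K)) else 0 := by
    split_ifs with hq
    · rfl
    · exact hω (-qi + (0 + qj)) _ (by omega) (hCih.mul (hK.comm hCj))
  have t2 : ω (Ciᴴ * (D * Cj - Cj * D)) = if qj = qi + 2 then ω (Ciᴴ * (D * Cj - Cj * D)) else 0 := by
    split_ifs with hq
    · rfl
    · exact hω (-qi + (-2 + qj)) _ (by omega) (hCih.mul (hD.comm hCj))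
  have t3 : ω (Ciᴴ * (Dᴴ * Cj - Cj * Dᴴ)) =
      if qj = qi - 2 then ω (Ciᴴ * (Dᴴ * Cj - Cj * Dᴴ)) else 0 := by
    split_ifs with hq
    · rfl
    · exact hω (-qi + (2 + qj)) _ (by omega) (hCih.mul (hDh.comm hCj))
  rw [smul_eq_mul, smul_eq_mul]
  conv_lhs => rw [t1, t2, t3]
  ring

/-- **One-point functions vanish.** Any charged observable has zero expectation in an invariant `ω` — in particular
the pair field `D` itself: an invariant feasible point gives objective value `0`. -/
theorem expect_eq_zero_of_invariant (hD : HasCharge Nc (-2) D) (hω : IsInvariant Nc ω) : ω D = 0 :=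
  hω (-2) D (by norm_num) hD

end Rows

/-! ### §3 Nesting in the field -/

/-- **Nesting in the field.** If `Q₀ ⪰ 0` and `Q₀ − h·T ⪰ 0` with `0 < h`, then `Q₀ − h'·T ⪰ 0` for every `0 ≤ h' ≤ h`
(convex combination): the set of fields at which a fixed invariant point passes the second-order rows is an interval
containing `0` — job K's KZa feasibility at `h_tree = 0.202` covers every smaller field. -/
theorem posSemidef_sub_smul_of_le {k : Type*} [Fintype k] {Q T : Matrix k k ℂ} {h h' : ℝ}
    (hQ : Q.PosSemidef) (hh : 0 < h) (hQT : (Q - (h : ℂ) • T).PosSemidef) (h0 : 0 ≤ h')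
    (hle : h' ≤ h) : (Q - (h' : ℂ) • T).PosSemidef := by
  have e : Q - (h' : ℂ) • T
      = ((1 - h' / h : ℝ) : ℂ) • Q + ((h' / h : ℝ) : ℂ) • (Q - (h : ℂ) • T) := by
    have hh' : (h : ℂ) ≠ 0 := by exact_mod_cast hh.ne'
    rw [smul_sub, smul_smul, Complex.ofReal_sub, Complex.ofReal_one, Complex.ofReal_div,
      div_mul_cancel₀ _ hh', sub_smul, one_smul]
    abel
  rw [e]
  refine Matrix.PosSemidef.add (hQ.smul ?_) (hQT.smul ?_)
  · exact Complex.zero_le_real.mpr (by rw [sub_nonneg]; exact div_le_one_of_le₀ hle hh.le)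
  · exact Complex.zero_le_real.mpr (by positivity)

/-! ### §4 The Ward–Bogoliubov border entry on invariant functionals -/

section WardBogoliubov

variable {Nc K D : Matrix n n ℂ} {ω : Matrix n n ℂ →ₗ[ℂ] ℂ}

/-- Jacobi bookkeeping for the Ward–Bogoliubov row: for a generator `Y` of charge `q`,
`[Nc, [A, Y]] = [[Nc, A], Y] + q • [A, Y]`. -/
theorem charge_doubleComm (A : Matrix n n ℂ) {Y : Matrix n n ℂ} {q : ℤ} (hY : HasCharge Nc q Y) :
    Nc * (A * Y - Y * A) - (A * Y - Y * A) * Nc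
      = ((Nc * A - A * Nc) * Y - Y * (Nc * A - A * Nc)) + (q : ℂ) • (A * Y - Y * A) := by
  unfold HasCharge at hY
  have h1 : (q : ℂ) • (A * Y - Y * A) = A * (Nc * Y - Y * Nc) - (Nc * Y - Y * Nc) * A := by
    rw [hY, Matrix.mul_smul, Matrix.smul_mul, smul_sub]
  rw [h1]
  simp only [sub_mul, mul_sub, Matrix.mul_assoc]
  abel

/-- The charge commutator of the sourced matrix: `[Nc, K − h(D + Dᴴ)] = 2h • D − 2h • Dᴴ` for neutral `K` and a
charge `−2` field `D` (p1's `sourced_comm_charge` is the `G = N/2` form). -/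
theorem charge_comm_sourced (hNc : Ncᴴ = Nc) (hK : HasCharge Nc 0 K) (hD : HasCharge Nc (-2) D)
    (h : ℂ) :
    Nc * (K - h • (D + Dᴴ)) - (K - h • (D + Dᴴ)) * Nc = (2 * h) • D - (2 * h) • Dᴴ := by
  have hDh : HasCharge Nc 2 Dᴴ := by simpa using hD.conjTranspose hNc
  unfold HasCharge at hK hD hDh
  have e : Nc * (K - h • (D + Dᴴ)) - (K - h • (D + Dᴴ)) * Nc
      = (Nc * K - K * Nc) - h • ((Nc * D - D * Nc) + (Nc * Dᴴ - Dᴴ * Nc)) := by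
    simp only [mul_sub, sub_mul, Matrix.mul_smul, Matrix.smul_mul, mul_add, add_mul, smul_add,
      smul_sub]
    abel
  rw [e, hK, hD, hDh]
  simp only [Int.cast_zero, zero_smul, Int.cast_neg, Int.cast_ofNat, smul_add, smul_smul, zero_sub,
    neg_smul, smul_neg]
  rw [show h * 2 = 2 * h by ring]
  abel

/-- **WB border on invariant pseudo-states.** For an invariant `ω`, a generator `Y` of charge `q` whose SOURCED
first-order row holds (`ω([A(h), Y]) = 0`) and whose torque rows hold (needed only for `q = ±2`), the Ward–Bogoliubov
entry `ω([Nc, [A(h), Y]])` VANISHES: the `Nc`-row of the WB matrix is the torque vector, so zero-torque invariant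
points pass the WB border (p1's `posSemidef_doubleCommutatorBlock`) with a zero off-diagonal row. -/
theorem wbEntry_eq_zero_of_invariant (hNc : Ncᴴ = Nc) (hK : HasCharge Nc 0 K)
    (hD : HasCharge Nc (-2) D) (hω : IsInvariant Nc ω) (h : ℂ) {Y : Matrix n n ℂ} {q : ℤ}
    (hY : HasCharge Nc q Y)
    (hR1 : ω ((K - h • (D + Dᴴ)) * Y - Y * (K - h • (D + Dᴴ))) = 0)
    (hb : q = 2 → ω (D * Y - Y * D) = 0)
    (hb' : q = -2 → ω (Dᴴ * Y - Y * Dᴴ) = 0) :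
    ω (Nc * ((K - h • (D + Dᴴ)) * Y - Y * (K - h • (D + Dᴴ)))
        - ((K - h • (D + Dᴴ)) * Y - Y * (K - h • (D + Dᴴ))) * Nc) = 0 := by
  have hDh : HasCharge Nc 2 Dᴴ := by simpa using hD.conjTranspose hNc
  rw [charge_doubleComm _ hY, charge_comm_sourced hNc hK hD h, map_add, map_smul, hR1, smul_zero,
    add_zero]
  have e : ((2 * h) • D - (2 * h) • Dᴴ) * Y - Y * ((2 * h) • D - (2 * h) • Dᴴ)
      = (2 * h) • (D * Y - Y * D) - (2 * h) • (Dᴴ * Y - Y * Dᴴ) := by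
    simp only [sub_mul, mul_sub, Matrix.smul_mul, Matrix.mul_smul, smul_sub]
    abel
  rw [e, map_sub, map_smul, map_smul]
  have t2 : ω (D * Y - Y * D) = 0 := by
    by_cases hq : q = 2
    · exact hb hq
    · exact hω (-2 + q) _ (by omega) (hD.comm hY)
  have t3 : ω (Dᴴ * Y - Y * Dᴴ) = 0 := by
    by_cases hq : q = -2
    · exact hb' hq
    · exact hω (2 + q) _ (by omega) (hDh.comm hY)
  simp [t2, t3]

end WardBogoliubov

/-! ### §5 The tree's objects fit the setting -/

section Hubbard

open Literature.MathematicalPhysics.QuantumLattice Literature.Probability.LatticeModels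

variable (L : ℕ) [NeZero L]

/-- **The pair field has charge `−2` under the particle number**: `N Δ_g − Δ_g N = −2 • Δ_g` on the torus
(KT94 (2.16), the tree's `DWaveKT.pairField_mul_totalNumber`). -/
theorem hasCharge_pairField (g : Site 2 → ℝ) : HasCharge totalNumber (-2) (pairField g L) := by
  unfold HasCharge
  rw [DWaveKT.pairField_mul_totalNumber L g]
  push_cast
  rw [neg_smul, sub_add_eq_sub_sub, sub_self, zero_sub]

/-- **The unsourced grand-canonical `t–t′` torus is neutral**: `[N, H(1,t′,U) − μN] = 0`. -/
theorem hasCharge_dWaveSourceTorusTT'_source_zero (t' U μ : ℝ) :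
    HasCharge totalNumber 0 (dWaveSourceTorusTT' L t' U μ 0) := by
  unfold HasCharge
  have hc : Commute (dWaveSourceTorusTT' L t' U μ 0) totalNumber := by
    rw [dWaveSourceTorusTT'_zero_source]
    exact (hubbardTorusTT'_commute_totalNumber L 1 t' U).sub_left ((Commute.refl _).smul_left _)
  rw [← hc.eq, sub_self, Int.cast_zero, zero_smul]

/-- Hence every `N`-invariant linear functional kills the `d`-wave pair field at every field `h`:
the one-point objective of the sourced KKT program is `0` on invariant pseudo-states. -/
theorem expect_pairField_eq_zero_of_invariant
    {ω : Matrix (Finset (Orb (FermionTorus 2 L))) (Finset (Orb (FermionTorus 2 L))) ℂ →ₗ[ℂ] ℂ}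
    (hω : IsInvariant totalNumber ω) : ω (pairField dWaveFormFactor L) = 0 :=
  expect_eq_zero_of_invariant (hasCharge_pairField L dWaveFormFactor) hω

end Hubbard

/-! ### §6 The mixture law (KKT + energy cap) -/

section MixtureLaw

variable {V : Type*} [AddCommGroup V] [Module ℝ V]

/-- **Mixture law (KKT + energy-cap, S7-type bound).** Let the feasible set `S` of a relaxation be convex, the energy
`E` and the objective `f` linear. If an invariant ("blind") feasible point `x₀` has objective `0` and energy `u + τ` (cap
excess `τ > 0`) and a physical feasible point `x₁` has objective `m₁` and energy `u − D` (depth `D ≥ 0`), then the mixture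
with weight `D/(D+τ)` on `x₀` is feasible, meets the cap `E ≤ u` exactly, and has objective `m₁·τ/(D+τ)`. Hence the
certified minimum of `f` under the cap is at most `m₁·τ/(D+τ)`. -/
theorem mixture_law {S : Set V} (hS : Convex ℝ S) (E f : V →ₗ[ℝ] ℝ) {x₀ x₁ : V} (hx₀ : x₀ ∈ S) (hx₁ : x₁ ∈ S)
    {u τ D m₁ : ℝ} (hτ : 0 < τ) (hD : 0 ≤ D) (hE₀ : E x₀ = u + τ) (hf₀ : f x₀ = 0) (hE₁ : E x₁ = u - D)
    (hf₁ : f x₁ = m₁) :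
    ∃ x ∈ S, E x = u ∧ f x = m₁ * (τ / (D + τ)) := by
  have hDτ : 0 < D + τ := by linarith
  refine ⟨(D / (D + τ)) • x₀ + (τ / (D + τ)) • x₁, ?_, ?_, ?_⟩
  · exact hS hx₀ hx₁ (div_nonneg hD hDτ.le) (div_nonneg hτ.le hDτ.le) (by field_simp)
  · rw [map_add, map_smul, map_smul, hE₀, hE₁, smul_eq_mul, smul_eq_mul]
    field_simp
    ring
  · rw [map_add, map_smul, map_smul, hf₀, hf₁, smul_eq_mul, smul_eq_mul, mul_zero, zero_add, mul_comm]

/-- The blind case of the mixture law: if the invariant feasible point already meets the cap (`E x₀ ≤ u`), the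
certified minimum of the objective under the cap is `≤ 0` — attained by `x₀` itself (critic-1 O10 corollary). -/
theorem mixture_law_blind {S : Set V} (E f : V →ₗ[ℝ] ℝ) {x₀ : V} (hx₀ : x₀ ∈ S) {u : ℝ} (hE₀ : E x₀ ≤ u)
    (hf₀ : f x₀ = 0) : ∃ x ∈ S, E x ≤ u ∧ f x ≤ 0 :=
  ⟨x₀, hx₀, hE₀, hf₀.le⟩

end MixtureLaw

end KKTBlindness

end Summit.Ventures.CertifiedManyBodySolver.Observables

end
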